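import Literature.NumberTheory.Sieve.FordAsymptoticSieveTypeI
import Literature.NumberTheory.Sieve.GeneralizedVonMangoldtCoprime
import Mathlib.Analysis.Complex.CauchyIntegral
import Mathlib.Analysis.SpecialFunctions.ExpDeriv
import Mathlib.Analysis.Calculus.IteratedDeriv.Lemmas
import Mathlib.Analysis.Calculus.ParametricIntegral
import Mathlib.Analysis.Calculus.MeanValue
import HarnessLib

/-!
# Ford's counterexamples to a fixed-level asymptotic sieve: the `Λ_k`-sums ((2.5), (3.11)–(3.14))

Topic `Literature/NumberTheory/Sieve`, sequel of `FordAsymptoticSieveTypeI.lean` (the construction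
`B(n)`, `Ford2004.Bump`). Source: K. Ford, *On Bombieri's asymptotic sieve*, Trans. Amer. Math.
Soc. **357** (2005) 1663–1674 (arXiv math/0401215) [Ford2004], §3, Theorem 3: the asymptotic
(3.9) `∑_{n ∈ I} a_n Λ_k(n) = K (log x)^{k−1}[k + (−1)^{M+1} Z_k + O(e^{−c₁√log x})]`, proved
there via (3.11)–(3.12) and the identity `W(M,N) = 0` (`2 ≤ N ≤ M`), `W(M,1) = −1` ((3.13)–
(3.14)).

## What is proved (perturbation part, product-form `f_{1_M}`)

* `Bump.lambdaK_est` — for every `k ≥ 1` there are `C_k, x_k` with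
  `‖∑_{x < n ≤ x+xη} Λ_k(n) B(n) − (−1)^{M−1} Z_k · xη (log x)^{k−1}‖ ≤ C_k xη² (log x)^{k−1}`
  for `x ≥ x_k` (`Λ_k` = the tree's `generalizedVonMangoldt`), and `Bump.Zk_pos` — `Z_k > 0`,
  where `Z_k = ∫ t^k Φ(t) Φ^{*(M−1)}(1−t) dt = (Φ_k * Φ^{*(M−1)})(1)` is Ford's
  `Z_k = ∫_{U_M} u_1^k f_{1_M}/(u_1⋯u_M)` for `f_{1_M} = ∏ u_i Φ(u_i)`.

## Method (a formalisation device replacing the `ε ∈ {0,1}^r`-bookkeeping of (3.11)–(3.13))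

Instead of expanding `Λ_k(p_1⋯p_r) = ∑_ε (−1)^{r−|ε|} (∑ ε_i log p_i)^k` and re-summing with the
multinomial theorem, we use the GENERATING arithmetic function `F_z = μ ⋆ n^{z/log x}`
(`Ford2004.moebPow`; `∂_z^k F_z(n)|₀ = Λ_k(n)/(log x)^k`, `iteratedDeriv_Egen`), which is
multiplicative with `F_z(p) = p^{z/log x} − 1`: hence `E_x(z) = ∑_{n ∈ I} B(n) F_z(n)` is the
subset sum of the TWISTED weight `t_p G_z(t_p)`, `G_z = e_z G − G` (`Bump.Gz`, `Egen_eq_SsumH`),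
to which the Type-I machinery of `FordAsymptoticSieveTypeI.lean` (tuples, `SsumH_eq_sum_
primeSum_sub`) and Lemma 2.2 (`primeSum_est`, uniformly in `‖z‖ ≤ 1`) apply verbatim. The main
terms now collapse, in the unitised convolution algebra, to
`exp(log(1 + e_zΦ) − log(1 + Φ)) − 1 = (1 + e_zΦ)(1 + Φ)⁻¹ − 1` whose degree-`M` part is
`(−1)^{M−1}(e_zΦ − Φ)Φ^{M−1}` (`Bump.mainTerm_eq`, from `Ford2004.apply_sum_pow_logCoeff_eq` —
this is (3.13)–(3.14) for all `N` at once), i.e.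
`E_x(z) = (xη/log x)(−1)^{M−1} F(z) + O(xη²/log x)` with
`F(z) = ∫ (e^{zt} − 1)Φ(t)Φ^{*(M−1)}(1−t) dt` (`Egen_est`). Both sides are entire; the `k`-th
derivative of `F` at `0` is `Z_k` (`iteratedDeriv_Fmain`, differentiation under the integral)
and CAUCHY'S ESTIMATE on `‖z‖ = 1` (`norm_iteratedDeriv_le`, from Mathlib's
`DiffContOnCl.circleIntegral_one_div_sub_center_pow_smul`) transfers the uniform `O(xη²/log x)`
to the `k`-th Taylor coefficient, giving `lambdaK_est`.

Everything here is PROVED (definitions with bodies and theorems; no named facts).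

## References

* K. Ford, *On Bombieri's asymptotic sieve*, Trans. AMS 357 (2005), 1663–1674, §3, Theorem 3,
  (3.9), (3.11)–(3.14) [Ford2004].
-/

noncomputable section

open Finset Real MeasureTheory Literature.Analysis.Convolution
open scoped Chebyshev

namespace Literature.Analysis.Convolution.ConvFun

/-! ### Twists by bounded characters: sup, Lipschitz and support bounds -/

/-- `|e^{zt}| ≤ e^{R b}` for `‖z‖ ≤ R`, `0 ≤ t ≤ b`. [folklore] -/
theorem norm_exp_mul_le {z : ℂ} {R t b : ℝ} (hz : ‖z‖ ≤ R) (ht0 : 0 ≤ t) (htb : t ≤ b) :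
    ‖Complex.exp (z * t)‖ ≤ Real.exp (R * b) := by
  rw [Complex.norm_exp]
  apply Real.exp_le_exp.mpr
  have h1 : (z * (t : ℂ)).re ≤ ‖z * (t : ℂ)‖ := Complex.re_le_norm _
  rw [norm_mul, Complex.norm_real, Real.norm_eq_abs, abs_of_nonneg ht0] at h1
  have hR : 0 ≤ R := (norm_nonneg _).trans hz
  nlinarith [norm_nonneg z]

/-- Mean value bound: `|e^{zt} − e^{zt'}| ≤ R e^{Rb} |t − t'|` for `t, t' ∈ [0, b]`, `‖z‖ ≤ R`.
[folklore] -/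
theorem norm_exp_mul_sub_le {z : ℂ} {R b t t' : ℝ} (hz : ‖z‖ ≤ R) (ht : t ∈ Set.Icc 0 b)
    (ht' : t' ∈ Set.Icc 0 b) :
    ‖Complex.exp (z * t) - Complex.exp (z * t')‖ ≤ R * Real.exp (R * b) * |t - t'| := by
  have hR : 0 ≤ R := (norm_nonneg _).trans hz
  -- the function `u ↦ exp(z u)` on the convex set `[0, b]`
  have hderiv : ∀ u ∈ Set.Icc (0 : ℝ) b,
      HasDerivWithinAt (fun u : ℝ => Complex.exp (z * u)) (z * Complex.exp (z * u)) (Set.Icc 0 b) u := by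
    intro u _
    have h1 : HasDerivAt (fun u : ℝ => z * (u : ℂ)) z u := by
      simpa using (Complex.ofRealCLM.hasDerivAt (x := u)).const_mul z
    exact (h1.cexp.hasDerivWithinAt).congr_deriv (by ring)
  have hbound : ∀ u ∈ Set.Icc (0 : ℝ) b, ‖z * Complex.exp (z * u)‖ ≤ R * Real.exp (R * b) := by
    intro u hu
    rw [norm_mul]
    exact mul_le_mul hz (norm_exp_mul_le hz hu.1 hu.2) (norm_nonneg _) hR
  have := Convex.norm_image_sub_le_of_norm_hasDerivWithin_le hderiv hbound (convex_Icc 0 b) ht' ht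
  rw [← Real.norm_eq_abs]
  exact this

/-- **Sup bound for a twisted difference**: `‖(e_z f − f)(t)‖ ≤ (e^{Rb} + 1) S` for `f` living on
`[a, b]` with `0 ≤ a`, `‖f‖ ≤ S`, `‖z‖ ≤ R`. [folklore] -/
theorem norm_mulExp_sub_apply_le {f : ConvFun} {a b S R : ℝ} {z : ℂ} (hz : ‖z‖ ≤ R)
    (hsupp : f.SuppIn a b) (ha : 0 ≤ a) (hS : ∀ t, ‖f t‖ ≤ S) (t : ℝ) :
    ‖(mulExp z f - f) t‖ ≤ (Real.exp (R * b) + 1) * S := by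
  have hS0 : 0 ≤ S := (norm_nonneg _).trans (hS 0)
  rw [mulExp_sub_self_apply, norm_mul]
  by_cases hft : f t = 0
  · rw [hft, norm_zero, mul_zero]; positivity
  · obtain ⟨h1, h2⟩ := hsupp t hft
    refine mul_le_mul ?_ (hS t) (norm_nonneg _) (by positivity)
    calc ‖Complex.exp (z * t) - 1‖ ≤ ‖Complex.exp (z * t)‖ + ‖(1 : ℂ)‖ := norm_sub_le _ _
      _ ≤ Real.exp (R * b) + 1 := by
          rw [norm_one]; exact add_le_add_left (norm_exp_mul_le hz (ha.trans h1) h2) _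

/-- **Lipschitz bound for a twisted difference**: if `f` lives on `[a, b]` (`0 ≤ a`), `‖f‖ ≤ S`
and `f` is `K`-Lipschitz, then `e_z f − f` is `((e^{Rb}+1) K + S R e^{Rb})`-Lipschitz for
`‖z‖ ≤ R`. [folklore] -/
theorem norm_mulExp_sub_apply_sub_le {f : ConvFun} {a b S K R : ℝ} {z : ℂ} (hz : ‖z‖ ≤ R)
    (hsupp : f.SuppIn a b) (ha : 0 ≤ a) (hS : ∀ t, ‖f t‖ ≤ S)
    (hK : ∀ t t', ‖f t - f t'‖ ≤ K * |t - t'|) (t t' : ℝ) :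
    ‖(mulExp z f - f) t - (mulExp z f - f) t'‖ ≤
      ((Real.exp (R * b) + 1) * K + S * (R * Real.exp (R * b))) * |t - t'| := by
  have hS0 : 0 ≤ S := (norm_nonneg _).trans (hS 0)
  have hK0 : 0 ≤ K := Literature.NumberTheory.Sieve.Ford2004.nonneg_of_lip hK
  have hR : 0 ≤ R := (norm_nonneg _).trans hz
  set E := Real.exp (R * b) with hE
  have hE0 : 0 < E := Real.exp_pos _
  have hexp1 : ∀ u, f u ≠ 0 → ‖Complex.exp (z * u) - 1‖ ≤ E + 1 := by
    intro u hu
    obtain ⟨h1, h2⟩ := hsupp u hu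
    calc ‖Complex.exp (z * u) - 1‖ ≤ ‖Complex.exp (z * u)‖ + ‖(1 : ℂ)‖ := norm_sub_le _ _
      _ ≤ E + 1 := by rw [norm_one]; exact add_le_add_left (norm_exp_mul_le hz (ha.trans h1) h2) _
  rw [mulExp_sub_self_apply, mulExp_sub_self_apply]
  -- the total constant dominates each of the partial ones
  have hSRE : 0 ≤ S * (R * E) := by positivity
  have htot : ∀ {A : ℝ}, A ≤ (E + 1) * K → A * |t - t'| ≤ ((E + 1) * K + S * (R * E)) * |t - t'| :=
    fun h => mul_le_mul_of_nonneg_right (h.trans (by linarith)) (abs_nonneg _)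
  by_cases hft : f t = 0
  · by_cases hft' : f t' = 0
    · rw [hft, hft', mul_zero, mul_zero, sub_zero, norm_zero]; positivity
    · -- `f t = 0`, `f t' ≠ 0`
      rw [hft, mul_zero, zero_sub, norm_neg, norm_mul]
      have : ‖f t'‖ = ‖f t' - f t‖ := by rw [hft, sub_zero]
      rw [this]
      calc ‖Complex.exp (z * t') - 1‖ * ‖f t' - f t‖ ≤ (E + 1) * (K * |t' - t|) :=
            mul_le_mul (hexp1 t' hft') (hK t' t) (norm_nonneg _) (by positivity)
        _ = (E + 1) * K * |t - t'| := by rw [abs_sub_comm]; ring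
        _ ≤ _ := htot le_rfl
  · by_cases hft' : f t' = 0
    · rw [hft', mul_zero, sub_zero, norm_mul]
      have : ‖f t‖ = ‖f t - f t'‖ := by rw [hft', sub_zero]
      rw [this]
      calc ‖Complex.exp (z * t) - 1‖ * ‖f t - f t'‖ ≤ (E + 1) * (K * |t - t'|) :=
            mul_le_mul (hexp1 t hft) (hK t t') (norm_nonneg _) (by positivity)
        _ = (E + 1) * K * |t - t'| := by ring
        _ ≤ _ := htot le_rfl
    · -- both in the support
      obtain ⟨ht1, ht2⟩ := hsupp t hft
      obtain ⟨ht1', ht2'⟩ := hsupp t' hft'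
      have hsplit : (Complex.exp (z * t) - 1) * f t - (Complex.exp (z * t') - 1) * f t' =
          (Complex.exp (z * t) - 1) * (f t - f t') + f t' * (Complex.exp (z * t) - Complex.exp (z * t')) := by
        ring
      rw [hsplit]
      refine (norm_add_le _ _).trans ?_
      rw [norm_mul, norm_mul]
      have h1 : ‖Complex.exp (z * t) - 1‖ * ‖f t - f t'‖ ≤ (E + 1) * (K * |t - t'|) :=
        mul_le_mul (hexp1 t hft) (hK t t') (norm_nonneg _) (by positivity)
      have h2 : ‖f t'‖ * ‖Complex.exp (z * t) - Complex.exp (z * t')‖ ≤ S * (R * E * |t - t'|) :=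
        mul_le_mul (hS t') (norm_exp_mul_sub_le hz ⟨ha.trans ht1, ht2⟩ ⟨ha.trans ht1', ht2'⟩)
          (norm_nonneg _) hS0
      calc _ ≤ (E + 1) * (K * |t - t'|) + S * (R * E * |t - t'|) := add_le_add h1 h2
        _ = ((E + 1) * K + S * (R * E)) * |t - t'| := by ring

/-- The twisted difference lives where `f` does. [folklore] -/
theorem suppIn_mulExp_sub {f : ConvFun} {a b : ℝ} (hf : f.SuppIn a b) (z : ℂ) :
    (ConvFun.mulExp z f - f).SuppIn a b :=
  (SuppIn.mulExp hf z).sub hf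

/-- Twisting is additive. [folklore] -/
theorem mulExp_add (z : ℂ) (f g : ConvFun) : mulExp z (f + g) = mulExp z f + mulExp z g := by
  ext t; simp [mulExp_apply, add_apply, mul_add]

/-- Twisting commutes with scalars. [folklore] -/
theorem mulExp_smul (z c : ℂ) (f : ConvFun) : mulExp z (c • f) = c • mulExp z f := by
  ext t; simp [mulExp_apply, smul_apply]; ring

/-- Twisting is additive over finite sums. [folklore] -/
theorem mulExp_sum {ι : Type*} (z : ℂ) (s : Finset ι) (f : ι → ConvFun) :
    mulExp z (∑ i ∈ s, f i) = ∑ i ∈ s, mulExp z (f i) := by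
  classical
  induction s using Finset.induction_on with
  | empty => ext t; simp [mulExp_apply]
  | insert a s ha ih => rw [Finset.sum_insert ha, Finset.sum_insert ha, mulExp_add, ih]

end Literature.Analysis.Convolution.ConvFun

namespace Literature.NumberTheory.Sieve.Ford2004

namespace Bump

variable (B : Bump)

/-! ### The twisted weight `G_z = e_z G − G` -/

/-- `G_z = e_z G − G`, so that `t_p G_z(t_p) = g(p) (p^{z/log x} − 1)`: twisting the weights
by the completely multiplicative function `n ↦ n^{z/log x}` ([Ford2004] (3.11), with the
generating variable `z` in place of the power `k` of `log`). [cite: Ford2004, §3 (3.11)] -/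
def Gz (z : ℂ) : ConvFun := ConvFun.mulExp z B.G - B.G

/-- `G_z(t) = (e^{zt} − 1) G(t)`. [folklore] -/
theorem Gz_apply (z : ℂ) (t : ℝ) : B.Gz z t = (Complex.exp (z * t) - 1) * B.G t :=
  ConvFun.mulExp_sub_self_apply z B.G t

/-- `G_z` in the unitised algebra: `∑ c_a ((e_z Φ)^a − Φ^a)` — the shape of
`Ford2004.apply_sum_pow_logCoeff_eq` with `Ψ = e_z Φ`. [folklore] -/
theorem inr_Gz (z : ℂ) : (B.Gz z : ConvFun.U) =
    ∑ a ∈ Icc 1 B.M, logCoeff ℂ a • ((ConvFun.mulExp z B.Φ : ConvFun.U) ^ a - (B.Φ : ConvFun.U) ^ a) := by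
  have h1 : ConvFun.mulExp z B.G = ∑ a ∈ Icc 1 B.M, (logCoeff ℂ a) • (ConvFun.mulExp z B.Φ).cpow a := by
    rw [G, ConvFun.mulExp_sum]
    refine Finset.sum_congr rfl fun a ha => ?_
    rw [ConvFun.mulExp_smul, ConvFun.mulExp_cpow _ _ (by have := (Finset.mem_Icc.mp ha).1; omega)]
  rw [Gz, Unitization.inr_sub]  -- `inr` is additive
  · rw [h1, B.inr_G]
    have h2 : ((∑ a ∈ Icc 1 B.M, logCoeff ℂ a • (ConvFun.mulExp z B.Φ).cpow a : ConvFun) : ConvFun.U) =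
        ∑ a ∈ Icc 1 B.M, logCoeff ℂ a • (ConvFun.mulExp z B.Φ : ConvFun.U) ^ a := by
      rw [show ((∑ a ∈ Icc 1 B.M, logCoeff ℂ a • (ConvFun.mulExp z B.Φ).cpow a : ConvFun) : ConvFun.U) =
          ∑ a ∈ Icc 1 B.M, ((logCoeff ℂ a • (ConvFun.mulExp z B.Φ).cpow a : ConvFun) : ConvFun.U) from
        map_sum (Unitization.inrNonUnitalAlgHom ℂ ConvFun) _ _]
      refine Finset.sum_congr rfl fun a ha => ?_
      rw [Unitization.inr_smul, ConvFun.inr_cpow _ (by have := (Finset.mem_Icc.mp ha).1; omega)]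
    rw [h2, ← Finset.sum_sub_distrib]
    refine Finset.sum_congr rfl fun a _ => ?_
    rw [smul_sub]

/-- The radius of the generating variable. [folklore] -/
def S₁ : ℝ := (Real.exp 2 + 1) * (1 / 4)

/-- A Lipschitz constant for all `G_z`, `‖z‖ ≤ 1`. [folklore] -/
def K₁ : ℝ := (Real.exp 2 + 1) * (B.M * B.K) + 1 / 4 * (1 * Real.exp 2)

/-- `‖G_z(t)‖ ≤ S₁` for `‖z‖ ≤ 1`. [folklore] -/
theorem norm_Gz_le {z : ℂ} (hz : ‖z‖ ≤ 1) (t : ℝ) : ‖B.Gz z t‖ ≤ S₁ := by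
  have := ConvFun.norm_mulExp_sub_apply_le (R := 1) hz B.suppIn_G B.ε_pos.le B.norm_G_le t
  rw [Gz, S₁]
  simpa using this

/-- `G_z` is `K₁`-Lipschitz for `‖z‖ ≤ 1`. [folklore] -/
theorem norm_Gz_sub_le {z : ℂ} (hz : ‖z‖ ≤ 1) (t t' : ℝ) :
    ‖B.Gz z t - B.Gz z t'‖ ≤ B.K₁ * |t - t'| := by
  have := ConvFun.norm_mulExp_sub_apply_sub_le (R := 1) hz B.suppIn_G B.ε_pos.le B.norm_G_le
    B.norm_G_sub_le t t'
  rw [Gz, K₁]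
  simpa using this

/-- `G_z` lives on `[ε, 2]`. [folklore] -/
theorem suppIn_Gz (z : ℂ) : (B.Gz z).SuppIn B.ε 2 := ConvFun.suppIn_mulExp_sub B.suppIn_G z

/-- `G_z` vanishes below `ε`. [folklore] -/
theorem Gz_vanish (z : ℂ) : ∀ t, B.Gz z t ≠ 0 → B.ε ≤ t := fun t ht => (B.suppIn_Gz z t ht).1

/-- `1 ≤ 2 S₁`. [folklore] -/
theorem one_le_two_S₁ : (1 : ℝ) ≤ 2 * S₁ := by
  rw [S₁]
  have : (1 : ℝ) ≤ Real.exp 2 := Real.one_le_exp (by norm_num)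
  nlinarith

/-- `‖t_p G_z(t_p)‖ ≤ 2 S₁`. [folklore] -/
theorem norm_wtH_Gz_le {z : ℂ} (hz : ‖z‖ ≤ 1) (x : ℝ) (p : ℕ) : ‖wtH (B.Gz z) x p‖ ≤ 2 * S₁ := by
  rw [wtH, norm_mul, Complex.norm_real, Real.norm_eq_abs]
  by_cases hG : B.Gz z (tOf x p) = 0
  · rw [hG, norm_zero, mul_zero]; exact le_trans zero_le_one one_le_two_S₁
  · obtain ⟨h1, h2⟩ := B.suppIn_Gz z _ hG
    have h0 : 0 ≤ tOf x p := B.ε_pos.le.trans h1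
    rw [abs_of_nonneg h0]
    exact mul_le_mul h2 (B.norm_Gz_le hz _) (norm_nonneg _) (by norm_num)

end Bump

/-! ### The arithmetic functions `n ↦ n^{z/log x}` and `μ ⋆ n^{z/log x}` -/

/-- `n ↦ n^{z/L} = exp(z log n/L)` as an arithmetic function (`0 ↦ 0`). [folklore] -/
def powAF (z : ℂ) (L : ℝ) : ArithmeticFunction ℂ :=
  ⟨fun n => if n = 0 then 0 else Complex.exp (z * (Real.log n / L)), if_pos rfl⟩

/-- `n^{z/L} = exp(z log n/L)` for `n ≠ 0`. [folklore] -/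
theorem powAF_apply {z : ℂ} {L : ℝ} {n : ℕ} (hn : n ≠ 0) :
    powAF z L n = Complex.exp (z * (Real.log n / L)) := if_neg hn

/-- `n ↦ n^{z/L}` is (completely) multiplicative. [folklore] -/
theorem isMultiplicative_powAF (z : ℂ) (L : ℝ) : (powAF z L).IsMultiplicative := by
  refine ⟨?_, ?_⟩
  · rw [powAF_apply one_ne_zero]; simp
  · intro m n _
    rcases Nat.eq_zero_or_pos m with rfl | hm
    · simp [powAF]
    rcases Nat.eq_zero_or_pos n with rfl | hn
    · simp [powAF]
    rw [powAF_apply (Nat.mul_ne_zero hm.ne' hn.ne'), powAF_apply hm.ne', powAF_apply hn.ne',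
      ← Complex.exp_add, Nat.cast_mul, Real.log_mul (by exact_mod_cast hm.ne') (by exact_mod_cast hn.ne')]
    push_cast
    ring_nf

/-- `F_z = μ ⋆ (n ↦ n^{z/L})`, the generating arithmetic function of the `Λ_k`:
`∂_z^k F_z(n)|_{z=0} = Λ_k(n)/L^k`. [folklore] -/
def moebPow (z : ℂ) (L : ℝ) : ArithmeticFunction ℂ :=
  (ArithmeticFunction.moebius : ArithmeticFunction ℂ) * powAF z L

/-- `F_z` is multiplicative. [folklore] -/
theorem isMultiplicative_moebPow (z : ℂ) (L : ℝ) : (moebPow z L).IsMultiplicative :=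
  ArithmeticFunction.isMultiplicative_moebius.intCast.mul (isMultiplicative_powAF z L)

/-- `F_z(n) = ∑_{ab = n} μ(a) b^{z/L}`. [folklore] -/
theorem moebPow_apply (z : ℂ) (L : ℝ) (n : ℕ) :
    moebPow z L n = ∑ x ∈ n.divisorsAntidiagonal,
      ((ArithmeticFunction.moebius x.1 : ℤ) : ℂ) * Complex.exp (z * (Real.log x.2 / L)) := by
  rw [moebPow, ArithmeticFunction.mul_apply]
  refine Finset.sum_congr rfl fun x hx => ?_
  have hx2 : x.2 ≠ 0 := by
    intro h
    have := Nat.mem_divisorsAntidiagonal.mp hx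
    exact this.2 (by rw [← this.1, h, mul_zero])
  rw [ArithmeticFunction.intCoe_apply, powAF_apply hx2]

/-- At a prime: `F_z(p) = p^{z/L} − 1`. [folklore] -/
theorem moebPow_prime (z : ℂ) (L : ℝ) {p : ℕ} (hp : p.Prime) :
    moebPow z L p = Complex.exp (z * (Real.log p / L)) - 1 := by
  rw [moebPow, ArithmeticFunction.mul_apply,
    Nat.sum_divisorsAntidiagonal (fun a b => ((ArithmeticFunction.moebius : ArithmeticFunction ℂ) a) * powAF z L b),
    hp.divisors, Finset.sum_pair hp.one_lt.ne]
  rw [Nat.div_one, Nat.div_self hp.pos, ArithmeticFunction.intCoe_apply, ArithmeticFunction.intCoe_apply,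
    ArithmeticFunction.moebius_apply_one, ArithmeticFunction.moebius_apply_prime hp,
    powAF_apply hp.ne_zero, powAF_apply one_ne_zero]
  simp only [Nat.cast_one, Real.log_one, zero_div, Complex.ofReal_zero, mul_zero, Complex.exp_zero,
    Int.cast_one, one_mul, Int.cast_neg, mul_one]
  ring

/-- On a squarefree product of primes: `F_z(∏ s) = ∏_{p ∈ s} (p^{z/log x} − 1)`. [folklore] -/
theorem moebPow_prod (z : ℂ) (x : ℝ) {s : Finset ℕ} (hs : ∀ p ∈ s, p.Prime) :
    moebPow z (Real.log x) (∏ p ∈ s, p) = ∏ p ∈ s, (Complex.exp (z * tOf x p) - 1) := by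
  rw [(isMultiplicative_moebPow z (Real.log x)).map_prod_of_prime s hs]
  refine Finset.prod_congr rfl fun p hp => ?_
  rw [moebPow_prime z _ (hs p hp), tOf]
  push_cast
  rfl

namespace Bump

variable (B : Bump)

/-! ### The generating sum `E_x(z) = ∑_{n ∈ I} B(n) F_z(n)` -/

/-- `E_x(z) = ∑_{x < n ≤ x+xη} F_z(n) B(n)`: the generating function in `z` of the sums
`∑_{n ∈ I} B(n) Λ_k(n)` (`k`-th `z`-derivative at `0`, times `(log x)^k`). [cite: Ford2004, §3 (3.11)] -/
def Egen (c₁ x : ℝ) (z : ℂ) : ℂ :=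
  ∑ n ∈ Finset.Ioc ⌊x⌋₊ ⌊x + x * eta c₁ x⌋₊, moebPow z (Real.log x) n * B.Bfun x n

/-- The window for `d = 1`. [folklore] -/
theorem mem_Ioc_iff_win_one {c₁ x : ℝ} (hx : 0 ≤ x) (m : ℕ) :
    m ∈ Finset.Ioc ⌊x⌋₊ ⌊x + x * eta c₁ x⌋₊ ↔ win c₁ x x (m : ℝ) := by
  have := mem_Ioc_iff_win (c₁ := c₁) hx Nat.one_pos m
  rwa [one_mul, Nat.cast_one, div_one] at this

/-- **`E_x(z)` is the subset sum of the twisted weight**: `E_x(z) = S_{G_z}(x)`. [folklore] -/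
theorem Egen_eq_SsumH {c₁ x : ℝ} (hx : 0 ≤ x) (z : ℂ) :
    B.Egen c₁ x z = SsumH (B.Gz z) c₁ x x := by
  classical
  rw [Egen, B.sum_mul_Bfun_eq, SsumH, Finset.sum_filter]
  refine Finset.sum_congr rfl fun s hs => ?_
  have hsP : ∀ p ∈ s, p.Prime := fun p hp => primesIn_prime (Finset.mem_powerset.mp hs hp)
  have hiff : (∏ p ∈ s, p) ∈ Finset.Ioc ⌊x⌋₊ ⌊x + x * eta c₁ x⌋₊ ↔
      win c₁ x x (∏ p ∈ s, ((p : ℕ) : ℝ)) := by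
    rw [mem_Ioc_iff_win_one hx]; push_cast; rfl
  by_cases h : win c₁ x x (∏ p ∈ s, ((p : ℕ) : ℝ))
  · rw [if_pos (hiff.mpr h), if_pos h, moebPow_prod z x hsP, ← Finset.prod_mul_distrib]
    refine Finset.prod_congr rfl fun p _ => ?_
    rw [wtH, B.Gz_apply, wt, wtH]; ring
  · rw [if_neg (fun h' => h (hiff.mp h')), if_neg h]

/-! ### The main term: `exp(log(1 + e_zΦ) − log(1 + Φ)) = (1 + e_zΦ)(1 + Φ)⁻¹` -/

/-- The main-term function `F(z) = ((e_z Φ) * Φ^{*(M−1)})(1) − Φ^{*M}(1) =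
∫ (e^{zs} − 1) Φ(s) Φ^{*(M−1)}(1 − s) ds`. [cite: Ford2004, §3 (3.9), (3.12)] -/
def Fmain (z : ℂ) : ℂ :=
  (ConvFun.mulExp z B.Φ * B.Φ.cpow (B.M - 1)) 1 - (B.Φ.cpow B.M) 1

/-- Degrees `< M` do not reach `1`: `m (1/M + w) < 1` for `m ≤ M − 1`. [folklore] -/
theorem deg_lt_upper {m : ℕ} (hm : m + 1 ≤ B.M) : (m : ℝ) * (1 / B.M + B.w) < 1 := by
  have hM0 := B.M_pos
  have hM2 := B.two_le_M
  have hm' : (m : ℝ) ≤ B.M - 1 := by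
    have : (m : ℝ) + 1 ≤ B.M := by exact_mod_cast hm
    linarith
  have hw := B.w_le
  calc (m : ℝ) * (1 / B.M + B.w) ≤ (B.M - 1) * (1 / B.M + 1 / (4 * (B.M : ℝ) ^ 2)) := by
        refine mul_le_mul hm' (by linarith) (by have := B.w_pos; positivity) (by linarith)
    _ < 1 := by
        rw [← sub_pos]
        have : (1 : ℝ) - (B.M - 1) * (1 / B.M + 1 / (4 * (B.M : ℝ) ^ 2)) =
            (3 * B.M + 1) / (4 * (B.M : ℝ) ^ 2) := by field_simp; ring
        rw [this]; positivity

/-- Degrees `> M` overshoot `1`: `1 < i (1/M − w)` for `i ≥ M + 1`. [folklore] -/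
theorem one_lt_deg_lower {i : ℕ} (hi : B.M < i) : (1 : ℝ) < (i : ℝ) * (1 / B.M - B.w) := by
  have h2 := B.one_add_lt_succ_mul_ε
  have h3 : (B.M + 1 : ℝ) * B.ε ≤ i * (1 / B.M - B.w) := by
    rw [Bump.ε]
    have : (B.M + 1 : ℝ) ≤ i := by exact_mod_cast hi
    exact mul_le_mul_of_nonneg_right this B.ε_pos.le
  have hM0 := B.M_pos
  have : (0 : ℝ) < 1 / (2 * B.M) := by positivity
  linarith

/-- **The main terms collapse** ([Ford2004] (3.12)–(3.14)): in the unitised convolution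
algebra `∑_{r=1}^{M} (1/r!) G_z^r = exp(log(1+Ψ) − log(1+Φ)) − 1 + (degree > M)`,
`Ψ = e_z Φ`; evaluating at `1` kills every degree except `M`, where the coefficient is
`(−1)^{M−1} (Ψ − Φ) Φ^{M−1}`: `∑_{r=1}^{M} (1/r!) G_z^{*r}(1) = (−1)^{M−1} F(z)`.
[cite: Ford2004, §3 (3.12)–(3.14)] -/
theorem mainTerm_eq (z : ℂ) :
    ∑ r ∈ Icc 1 B.M, ((r.factorial : ℂ)⁻¹) * (B.Gz z).cpow r 1 = (-1) ^ (B.M - 1) * B.Fmain z := by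
  set Ψ : ConvFun.U := (ConvFun.mulExp z B.Φ : ConvFun.U) with hΨ
  set Φ' : ConvFun.U := (B.Φ : ConvFun.U) with hΦ'
  have hsuppΨ : (ConvFun.mulExp z B.Φ).SuppIn (1 / B.M - B.w) (1 / B.M + B.w) := B.supp.mulExp z
  have hab : 1 / (B.M : ℝ) - B.w ≤ 1 / B.M + B.w := by linarith [B.w_pos]
  have hM1 : B.M - 1 ≠ 0 := by have := B.two_le; omega
  -- move to `U`
  have h1 : ∑ r ∈ Icc 1 B.M, ((r.factorial : ℂ)⁻¹) * (B.Gz z).cpow r 1 =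
      ConvFun.ev 1 (∑ r ∈ Icc 1 B.M, algebraMap ℂ ConvFun.U ((r.factorial : ℂ)⁻¹) *
        (∑ a ∈ Icc 1 B.M, logCoeff ℂ a • (Ψ ^ a - Φ' ^ a)) ^ r) := by
    rw [map_sum]
    refine Finset.sum_congr rfl fun r hr => ?_
    have hr0 : r ≠ 0 := by have := (Finset.mem_Icc.mp hr).1; omega
    rw [← B.inr_Gz z, Algebra.algebraMap_eq_smul_one, smul_mul_assoc, one_mul, LinearMap.map_smul,
      ← ConvFun.inr_cpow _ hr0, ConvFun.ev_inr, smul_eq_mul]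
  rw [h1, apply_sum_pow_logCoeff_eq (𝕜 := ℂ) B.M Ψ Φ' (ConvFun.ev 1)]
  · -- only the degree-`M` term survives
    have hsmul : ∀ (n : ℕ) (X : ConvFun.U), (-1 : ConvFun.U) ^ n * X = ((-1 : ℂ) ^ n) • X := by
      intro n X
      rw [Algebra.smul_def, map_pow, map_neg, map_one]
    have hsplit : ∀ m : ℕ, 1 ≤ m → ConvFun.ev 1 ((Ψ - Φ') * Φ' ^ (m - 1)) =
        ConvFun.ev 1 (Ψ ^ 1 * Φ' ^ (m - 1)) - ConvFun.ev 1 (Φ' ^ 1 * Φ' ^ (m - 1)) := by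
      intro m _
      rw [sub_mul, map_sub, pow_one, pow_one]
    rw [Finset.sum_eq_single_of_mem B.M (Finset.mem_Icc.mpr ⟨le_trans (by norm_num) B.two_le, le_rfl⟩)]
    · -- the degree-`M` term
      rw [hsmul, LinearMap.map_smul, smul_eq_mul]
      congr 1
      rw [sub_mul, map_sub, Fmain, ← pow_succ', Nat.sub_add_cancel (le_trans (by norm_num) B.two_le),
        hΦ', ← ConvFun.inr_cpow _ hM1, hΨ, ← Unitization.inr_mul, ConvFun.ev_inr,
        ← ConvFun.inr_cpow _ (by have := B.two_le; omega), ConvFun.ev_inr]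
    · intro m hm hne
      have hm1 : 1 ≤ m := (Finset.mem_Icc.mp hm).1
      have hmM : m + 1 ≤ B.M := by
        have := (Finset.mem_Icc.mp hm).2
        omega
      rw [hsmul, LinearMap.map_smul, hsplit m hm1]
      have hcond : (1 : ℝ) < ((1 + (m - 1) : ℕ) : ℝ) * (1 / B.M - B.w) ∨
          ((1 + (m - 1) : ℕ) : ℝ) * (1 / B.M + B.w) < 1 := by
        rw [show 1 + (m - 1) = m by omega]
        exact Or.inr (B.deg_lt_upper hmM)
      rw [ConvFun.ev_pow_mul_pow_eq_zero hsuppΨ B.supp hab (by omega) hcond,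
        ConvFun.ev_pow_mul_pow_eq_zero B.supp B.supp hab (by omega) hcond, sub_zero, smul_zero]
  · -- junk of degree `> M` vanishes at `1`
    intro i j hij
    refine ConvFun.ev_pow_mul_pow_eq_zero hsuppΨ B.supp hab (by omega) (Or.inl ?_)
    exact B.one_lt_deg_lower hij

/-! ### The uniform estimate `E_x(z) = (xη/log x)(−1)^{M−1} F(z) + O(xη²/log x)`, `‖z‖ ≤ 1` -/

/-- `x^a ≥ a log x` for `x > 0`, `a ≥ 0` (from `e^u ≥ 1 + u`). [folklore] -/
theorem mul_log_le_rpow {x a : ℝ} (hx : 0 < x) : a * Real.log x ≤ x ^ a := by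
  rw [Real.rpow_def_of_pos hx]
  have := Real.add_one_le_exp (Real.log x * a)
  nlinarith

/-- The largeness conditions for the `Λ_k`-sums: `4x < x^{(M+1)ε}` and the two non-injective
error terms are `O(xη²/log x)`. [folklore] -/
theorem thresholdsB {c₁ x : ℝ} (hc₁ : 0 < c₁) (hx1 : 1 < x) (hL1 : 1 ≤ Real.log x)
    (hxa : Real.exp ((4 * c₁ / B.ε) ^ 2) ≤ x) (hxb : Real.exp ((8 * c₁) ^ 2) ≤ x)
    (hxc : Real.exp (4 * B.M) ≤ x) :
    4 * x < x ^ ((B.M + 1 : ℝ) * B.ε) ∧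
      (x * eta c₁ x + 1) * (2 / x ^ B.ε) ≤ 8 / B.ε * (x * eta c₁ x ^ 2 / Real.log x) ∧
      Real.sqrt (x * (1 + eta c₁ x)) + 1 ≤ 12 * (x * eta c₁ x ^ 2 / Real.log x) := by
  have hx0 : 0 < x := by linarith
  have hε := B.ε_pos
  set η := eta c₁ x with hη
  set L := Real.log x with hL
  have hη0 : 0 < η := eta_pos c₁ x
  have hη1 : η ≤ 1 := eta_le_one hc₁.le x
  have hL0 : 0 < L := by linarith
  -- (T3) via the Type-I thresholds lemma (only its third component is used)
  have hT3 : 4 * x < x ^ ((B.M + 1 : ℝ) * B.ε) :=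
    (B.thresholds (c₁ := c₁) one_pos hx1 (le_trans (Real.exp_le_exp.mpr (by
      have : (2 * c₁ / B.ε) ^ 2 ≤ (4 * c₁ / B.ε) ^ 2 := by
        rw [div_pow, div_pow]; gcongr; nlinarith
      exact this)) hxa) (le_trans (Real.exp_le_exp.mpr (by
      have : (4 * c₁ / 1) ^ 2 ≤ (8 * c₁) ^ 2 := by rw [div_one]; nlinarith
      exact this)) hxb) hxc).2.2
  refine ⟨hT3, ?_, ?_⟩
  · -- `1/x^ε ≤ 2η²/(εL)`
    have h1 : 1 ≤ η ^ 2 * x ^ (B.ε / 2) :=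
      one_le_eta_sq_mul_rpow (by positivity) hx1 (by
        have := le_log_of_exp_le hxa
        calc (2 * c₁ / (B.ε / 2)) ^ 2 = (4 * c₁ / B.ε) ^ 2 := by ring
          _ ≤ Real.log x := this)
    have h2 : B.ε / 2 * L ≤ x ^ (B.ε / 2) := mul_log_le_rpow hx0
    have h3 : x ^ B.ε = x ^ (B.ε / 2) * x ^ (B.ε / 2) := by rw [← Real.rpow_add hx0]; ring_nf
    have hxe : 0 < x ^ (B.ε / 2) := Real.rpow_pos_of_pos hx0 _
    have h4 : 2 / x ^ B.ε ≤ 4 * η ^ 2 / (B.ε * L) := by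
      rw [h3, div_le_div_iff₀ (by positivity) (by positivity)]
      -- `2 ε L ≤ 4 η² x^{ε/2} x^{ε/2}` from `εL/2 ≤ x^{ε/2}` and `1 ≤ η² x^{ε/2}`
      have := mul_le_mul h2 h1 zero_le_one hxe.le
      nlinarith
    have h5 : x * η + 1 ≤ 2 * x := by nlinarith
    calc (x * η + 1) * (2 / x ^ B.ε) ≤ (2 * x) * (4 * η ^ 2 / (B.ε * L)) :=
          mul_le_mul h5 h4 (by positivity) (by positivity)
      _ = 8 / B.ε * (x * η ^ 2 / L) := by field_simp; norm_num
  · -- `1/√x ≤ 4η²/L`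
    have h1 : 1 ≤ η ^ 2 * x ^ (1 / 4 : ℝ) :=
      one_le_eta_sq_mul_rpow (by norm_num) hx1 (by
        have := le_log_of_exp_le hxb
        calc (2 * c₁ / (1 / 4)) ^ 2 = (8 * c₁) ^ 2 := by ring
          _ ≤ Real.log x := this)
    have h2 : 1 / 4 * L ≤ x ^ (1 / 4 : ℝ) := mul_log_le_rpow hx0
    have h3 : Real.sqrt x = x ^ (1 / 4 : ℝ) * x ^ (1 / 4 : ℝ) := by
      rw [Real.sqrt_eq_rpow, ← Real.rpow_add hx0]; norm_num
    have hx4 : 0 < x ^ (1 / 4 : ℝ) := Real.rpow_pos_of_pos hx0 _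
    have h4 : L ≤ 4 * η ^ 2 * Real.sqrt x := by
      rw [h3]
      have := mul_le_mul h2 h1 zero_le_one hx4.le
      nlinarith
    have h5 : Real.sqrt (x * (1 + η)) + 1 ≤ 3 * Real.sqrt x := by
      have h6 : Real.sqrt (x * (1 + η)) ≤ 2 * Real.sqrt x := by
        rw [show 2 * Real.sqrt x = Real.sqrt (2 ^ 2 * x) by
          rw [Real.sqrt_mul (by norm_num), Real.sqrt_sq (by norm_num)]]
        exact Real.sqrt_le_sqrt (by nlinarith)
      have h7 : 1 ≤ Real.sqrt x := by
        rw [show (1:ℝ) = Real.sqrt 1 by simp]; exact Real.sqrt_le_sqrt hx1.le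
      linarith
    have hsx : 0 < Real.sqrt x := Real.sqrt_pos.mpr hx0
    have h8 : 3 * Real.sqrt x ≤ 12 * (x * η ^ 2 / L) := by
      -- `3 √x · L ≤ 12 x η²` since `√x · L ≤ 4 η² √x √x = 4 η² x`
      rw [mul_div_assoc', le_div_iff₀ hL0]
      have h9 : Real.sqrt x * Real.sqrt x = x := Real.mul_self_sqrt hx0.le
      nlinarith
    linarith

/-- **The generating sum, uniformly on `‖z‖ ≤ 1`**:
`E_x(z) = (xη/log x) (−1)^{M−1} F(z) + O(xη²/log x)` for `x ≥ x₁`. [cite: Ford2004, §3 (3.11)–(3.12)] -/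
theorem Egen_est {c C : ℝ} (hc : 0 < c)
    (hPNT : ∀ u : ℝ, 2 ≤ u → |θ u - u| ≤ C * u / Real.exp (c * Real.sqrt (Real.log u)))
    {c₁ : ℝ} (hc₁ : 0 < c₁) (hc₁' : c₁ ≤ c * Real.sqrt B.ε / 4) :
    ∃ D₀ x₁ : ℝ, 0 ≤ D₀ ∧ ∀ x : ℝ, x₁ ≤ x → ∀ z : ℂ, ‖z‖ ≤ 1 →
      ‖B.Egen c₁ x z - ((x * eta c₁ x / Real.log x : ℝ) : ℂ) * ((-1) ^ (B.M - 1) * B.Fmain z)‖ ≤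
        D₀ * x * eta c₁ x ^ 2 / Real.log x := by
  classical
  have hε := B.ε_pos
  have hε1 := B.ε_le_one
  have hM0 := B.M_pos
  have hS0 : (0 : ℝ) ≤ S₁ := by rw [S₁]; positivity
  have hK0 : 0 ≤ B.K₁ := by
    rw [K₁]; have := nonneg_of_lip B.lip; positivity
  -- constants of Lemma 2.2 for the family `G_z`
  have key : ∀ r : ℕ, ∃ C₀ : ℝ, 0 ≤ C₀ ∧ (1 ≤ r → ∀ x : ℝ, xThreshold B.ε ≤ x →
      ∀ z : ℂ, ‖z‖ ≤ 1 → ∀ y : ℝ, 0 < y → y ≤ 2 * x →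
        ‖primeSum c₁ x (B.Gz z) r y -
            ((y * eta c₁ x / Real.log x : ℝ) : ℂ) * (B.Gz z).cpow r (Real.log y / Real.log x)‖ ≤
          C₀ * y * eta c₁ x ^ 2 / Real.log x) := by
    intro r
    rcases Nat.eq_zero_or_pos r with rfl | hr
    · exact ⟨0, le_rfl, fun h => absurd h (by norm_num)⟩
    · obtain ⟨C₀, hC₀, h⟩ := primeSum_est hc hPNT hε hε1 hS0 hK0 (r := r) hr
      exact ⟨C₀, hC₀, fun _ x hx z hz y hy hyx =>
        h x hx c₁ hc₁ hc₁' (B.Gz z) (B.norm_Gz_le hz) (B.norm_Gz_sub_le hz) (B.suppIn_Gz z) y hy hyx⟩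
  choose Cf hCf0 hCf using key
  set D₀ : ℝ := ∑ r ∈ Icc 1 B.M, (Cf r + (2 * S₁) ^ r * (r : ℝ) ^ r * (8 / B.ε + 12)) with hD₀
  have hD₀0 : 0 ≤ D₀ := Finset.sum_nonneg fun r _ => by have := hCf0 r; positivity
  refine ⟨D₀, max (xThreshold B.ε) (max (Real.exp ((4 * c₁ / B.ε) ^ 2))
    (max (Real.exp ((8 * c₁) ^ 2)) (Real.exp (4 * B.M)))), hD₀0, fun x hx z hz => ?_⟩
  rw [max_le_iff, max_le_iff, max_le_iff] at hx
  obtain ⟨hxT, hxa, hxb, hxc⟩ := hx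
  obtain ⟨hxe, _, hx16⟩ := xThreshold_spec hε hε1 hxT
  have hx1 : 1 < x := by linarith
  have hx0 : 0 < x := by linarith
  set η := eta c₁ x with hηdef
  set L := Real.log x with hLdef
  have hL1 : 1 ≤ L := by
    rw [hLdef, ← Real.log_exp 1]; exact Real.log_le_log (Real.exp_pos 1) hxe
  have hL0 : 0 < L := by linarith
  have hη0 : 0 < η := eta_pos c₁ x
  obtain ⟨hT3, hN1, hN2⟩ := B.thresholdsB hc₁ hx1 hL1 hxa hxb hxc
  -- through ordered tuples
  rw [B.Egen_eq_SsumH hx0.le z,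
    SsumH_eq_sum_primeSum_sub hx1 hε (B.Gz_vanish z) hc₁.le hT3 hx1.le (by linarith)]
  set P := primesIn 0 ⌊x ^ 2⌋₊ with hP
  set E : ℕ → ℂ := fun r => primeSum c₁ x (B.Gz z) r x - ((x * η / L : ℝ) : ℂ) * (B.Gz z).cpow r 1 with hE
  set N : ℕ → ℂ := fun r => ∑ u ∈ (Fintype.piFinset (fun _ : Fin r => P)).filter
      (fun u => ¬ Function.Injective u),
      (if win c₁ x x (∏ i, ((u i : ℕ) : ℝ)) then ∏ i, wtH (B.Gz z) x (u i) else 0) with hN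
  have hmain : ∑ r ∈ Icc 1 B.M, ((r.factorial : ℂ)⁻¹) * (primeSum c₁ x (B.Gz z) r x - N r) =
      ∑ r ∈ Icc 1 B.M, ((r.factorial : ℂ)⁻¹) * (E r - N r) +
        ((x * η / L : ℝ) : ℂ) * ((-1) ^ (B.M - 1) * B.Fmain z) := by
    rw [← B.mainTerm_eq z, Finset.mul_sum, ← Finset.sum_add_distrib]
    refine Finset.sum_congr rfl fun r _ => ?_
    simp only [hE]; ring
  change ‖∑ r ∈ Icc 1 B.M, ((r.factorial : ℂ)⁻¹) * (primeSum c₁ x (B.Gz z) r x - N r) - _‖ ≤ _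
  rw [hmain, add_sub_cancel_right]
  -- termwise
  have hLog1 : Real.log x / Real.log x = 1 := div_self hL0.ne'
  refine (norm_sum_le _ _).trans ?_
  have hterm : ∀ r ∈ Icc 1 B.M, ‖((r.factorial : ℂ)⁻¹) * (E r - N r)‖ ≤
      (Cf r + (2 * S₁) ^ r * (r : ℝ) ^ r * (8 / B.ε + 12)) * (x * η ^ 2 / L) := by
    intro r hr
    have hr1 : 1 ≤ r := (Finset.mem_Icc.mp hr).1
    have hfac : ‖((r.factorial : ℂ)⁻¹)‖ ≤ 1 := by
      rw [norm_inv, Complex.norm_natCast]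
      exact inv_le_one_of_one_le₀ (by exact_mod_cast Nat.one_le_iff_ne_zero.mpr r.factorial_ne_zero)
    rw [norm_mul]
    refine (mul_le_mul hfac le_rfl (norm_nonneg _) zero_le_one).trans ?_
    rw [one_mul]
    refine (norm_sub_le _ _).trans ?_
    have h1 : ‖E r‖ ≤ Cf r * (x * η ^ 2 / L) := by
      have := hCf r hr1 x hxT z hz x hx0 (by linarith)
      rw [hLog1] at this
      calc ‖E r‖ ≤ Cf r * x * eta c₁ x ^ 2 / Real.log x := this
        _ = Cf r * (x * η ^ 2 / L) := by ring
    have h2 : ‖N r‖ ≤ (2 * S₁) ^ r * (r : ℝ) ^ r * (8 / B.ε + 12) * (x * η ^ 2 / L) := by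
      have h3 := norm_sum_nonInj_le (H := B.Gz z) (W₀ := 2 * S₁) (c₁ := c₁) hx1 hε
        one_le_two_S₁ (B.norm_wtH_Gz_le hz x) (B.Gz_vanish z) r hx0.le
      refine h3.trans ?_
      have h4 : (x * η + 1) * (2 / x ^ B.ε) + (Real.sqrt (x * (1 + η)) + 1) ≤
          (8 / B.ε + 12) * (x * η ^ 2 / L) := by
        have := add_le_add hN1 hN2; linarith
      calc (2 * S₁) ^ r * ((r : ℝ) ^ r * ((x * η + 1) * (2 / x ^ B.ε) + (Real.sqrt (x * (1 + η)) + 1)))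
          ≤ (2 * S₁) ^ r * ((r : ℝ) ^ r * ((8 / B.ε + 12) * (x * η ^ 2 / L))) := by gcongr
        _ = (2 * S₁) ^ r * (r : ℝ) ^ r * (8 / B.ε + 12) * (x * η ^ 2 / L) := by ring
    calc ‖E r‖ + ‖N r‖ ≤ Cf r * (x * η ^ 2 / L) + (2 * S₁) ^ r * (r : ℝ) ^ r * (8 / B.ε + 12) * (x * η ^ 2 / L) :=
          add_le_add h1 h2
      _ = (Cf r + (2 * S₁) ^ r * (r : ℝ) ^ r * (8 / B.ε + 12)) * (x * η ^ 2 / L) := by ring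
  refine (Finset.sum_le_sum hterm).trans (le_of_eq ?_)
  rw [← Finset.sum_mul, hD₀]; ring

/-! ### Extracting the `Λ_k`: derivatives at `z = 0` -/

/-- The `Λ_k`-sum of the construction: `∑_{x < n ≤ x+xη} Λ_k(n) B(n)`.
[cite: Ford2004, §3 (3.11)–(3.12)] -/
def LamSum (c₁ x : ℝ) (k : ℕ) : ℂ :=
  ∑ n ∈ Finset.Ioc ⌊x⌋₊ ⌊x + x * eta c₁ x⌋₊, ((generalizedVonMangoldt k n : ℝ) : ℂ) * B.Bfun x n

/-- `E_x` written as a finite combination of exponentials `e^{c z}`. [folklore] -/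
theorem Egen_eq (c₁ x : ℝ) (z : ℂ) :
    B.Egen c₁ x z = ∑ n ∈ Finset.Ioc ⌊x⌋₊ ⌊x + x * eta c₁ x⌋₊, B.Bfun x n *
      ∑ ab ∈ n.divisorsAntidiagonal, ((ArithmeticFunction.moebius ab.1 : ℤ) : ℂ) *
        Complex.exp (((Real.log ab.2 / Real.log x : ℝ) : ℂ) * z) := by
  rw [Egen]
  refine Finset.sum_congr rfl fun n _ => ?_
  rw [moebPow_apply, mul_comm]
  congr 1
  refine Finset.sum_congr rfl fun ab _ => ?_
  congr 1
  push_cast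
  ring_nf

/-- `E_x` is entire. [folklore] -/
theorem contDiff_Egen (c₁ x : ℝ) {n : WithTop ℕ∞} : ContDiff ℂ n (B.Egen c₁ x) := by
  have : B.Egen c₁ x = fun z => ∑ m ∈ Finset.Ioc ⌊x⌋₊ ⌊x + x * eta c₁ x⌋₊, B.Bfun x m *
      ∑ ab ∈ m.divisorsAntidiagonal, ((ArithmeticFunction.moebius ab.1 : ℤ) : ℂ) *
        Complex.exp (((Real.log ab.2 / Real.log x : ℝ) : ℂ) * z) := funext (B.Egen_eq c₁ x)
  rw [this]
  refine ContDiff.sum fun m _ => contDiff_const.mul (ContDiff.sum fun ab _ => contDiff_const.mul ?_)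
  exact Complex.contDiff_exp.comp (contDiff_const.mul contDiff_id)

/-- **`∂_z^k E_x(0) = (log x)^{−k} ∑_{n ∈ I} Λ_k(n) B(n)`**: the `k`-th derivative of
`n^{z/log x}` at `0` is `(log n/log x)^k`, and `μ ⋆ log^k = Λ_k`. [folklore] -/
theorem iteratedDeriv_Egen (c₁ x : ℝ) (k : ℕ) :
    iteratedDeriv k (B.Egen c₁ x) 0 = B.LamSum c₁ x k / (Real.log x : ℂ) ^ k := by
  have hfun : B.Egen c₁ x = fun z => ∑ m ∈ Finset.Ioc ⌊x⌋₊ ⌊x + x * eta c₁ x⌋₊, B.Bfun x m *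
      ∑ ab ∈ m.divisorsAntidiagonal, ((ArithmeticFunction.moebius ab.1 : ℤ) : ℂ) *
        Complex.exp (((Real.log ab.2 / Real.log x : ℝ) : ℂ) * z) := funext (B.Egen_eq c₁ x)
  have hexp : ∀ c : ℂ, ContDiff ℂ k (fun z : ℂ => Complex.exp (c * z)) := fun c =>
    Complex.contDiff_exp.comp (contDiff_const.mul contDiff_id)
  have hinner : ∀ m : ℕ, ContDiff ℂ k (fun z : ℂ => ∑ ab ∈ m.divisorsAntidiagonal,
      ((ArithmeticFunction.moebius ab.1 : ℤ) : ℂ) * Complex.exp (((Real.log ab.2 / Real.log x : ℝ) : ℂ) * z)) :=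
    fun m => ContDiff.sum fun ab _ => contDiff_const.mul (hexp _)
  rw [hfun, iteratedDeriv_fun_sum fun m _ => (contDiff_const.mul (hinner m)).contDiffAt]
  rw [LamSum, Finset.sum_div]
  refine Finset.sum_congr rfl fun m _ => ?_
  rw [iteratedDeriv_const_mul _ (hinner m).contDiffAt,
    iteratedDeriv_fun_sum fun ab _ => (contDiff_const.mul (hexp _)).contDiffAt]
  have hterm : ∀ ab ∈ m.divisorsAntidiagonal,
      iteratedDeriv k (fun z => ((ArithmeticFunction.moebius ab.1 : ℤ) : ℂ) *
        Complex.exp (((Real.log ab.2 / Real.log x : ℝ) : ℂ) * z)) 0 =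
      ((ArithmeticFunction.moebius ab.1 : ℤ) : ℂ) * ((Real.log ab.2 / Real.log x : ℝ) : ℂ) ^ k := by
    intro ab _
    rw [iteratedDeriv_const_mul _ (hexp _).contDiffAt, iteratedDeriv_cexp_const_mul]
    simp
  rw [Finset.sum_congr rfl hterm, generalizedVonMangoldt_apply', Complex.ofReal_sum, Finset.sum_mul,
    Finset.sum_div, Finset.mul_sum]
  refine Finset.sum_congr rfl fun ab _ => ?_
  push_cast
  rw [div_pow]
  ring

/-! ### The main-term function: derivatives of `F(z) = ∫ (e^{zt} − 1) Φ(t) Φ^{*(M−1)}(1−t) dt` -/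

/-- The kernel `K(t) = Φ(t) Φ^{*(M−1)}(1 − t)`. [folklore] -/
def kernel (t : ℝ) : ℂ := B.Φ t * B.Φ.cpow (B.M - 1) (1 - t)

/-- The kernel is continuous. [folklore] -/
theorem continuous_kernel : Continuous B.kernel :=
  B.Φ.continuous.mul ((B.Φ.cpow (B.M - 1)).continuous.comp (continuous_const.sub continuous_id))

/-- The kernel has compact support. [folklore] -/
theorem hasCompactSupport_kernel : HasCompactSupport B.kernel :=
  B.Φ.hasCompactSupport.mul_right

/-- The moments `M_j(z) = ∫ t^j e^{zt} K(t) dt`. [folklore] -/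
def moment (j : ℕ) (z : ℂ) : ℂ := ∫ t : ℝ, ((t : ℂ) ^ j * Complex.exp (z * t)) * B.kernel t

/-- `F(z) = M_0(z) − M_0(0)`. [folklore] -/
theorem Fmain_eq (z : ℂ) : B.Fmain z = B.moment 0 z - B.moment 0 0 := by
  have hM1 : B.M - 1 ≠ 0 := by have := B.two_le; omega
  rw [Fmain, ConvFun.mul_apply, show B.M = B.M - 1 + 1 by omega, ConvFun.cpow_succ _ hM1,
    Nat.add_sub_cancel, ConvFun.mul_apply, moment, moment]
  congr 1
  · refine integral_congr_ae (Filter.Eventually.of_forall fun t => ?_)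
    simp [kernel, ConvFun.mulExp_apply]; ring
  · refine integral_congr_ae (Filter.Eventually.of_forall fun t => ?_)
    simp [kernel]

/-- Continuity of the moment integrands and their compact support. [folklore] -/
theorem continuous_momentIntegrand (j : ℕ) (z : ℂ) :
    Continuous fun t : ℝ => ((t : ℂ) ^ j * Complex.exp (z * t)) * B.kernel t :=
  (((Complex.continuous_ofReal.pow j).mul (Complex.continuous_exp.comp
    (continuous_const.mul Complex.continuous_ofReal))).mul B.continuous_kernel)

/-- The moment integrands have compact support. [folklore] -/
theorem hasCompactSupport_momentIntegrand (j : ℕ) (z : ℂ) :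
    HasCompactSupport fun t : ℝ => ((t : ℂ) ^ j * Complex.exp (z * t)) * B.kernel t :=
  B.hasCompactSupport_kernel.mul_left

/-- `M_j' = M_{j+1}` (differentiation under the integral sign, dominated on compact support).
[folklore] -/
theorem hasDerivAt_moment (j : ℕ) (z₀ : ℂ) : HasDerivAt (B.moment j) (B.moment (j + 1) z₀) z₀ := by
  -- a bound on the support
  obtain ⟨R, hR⟩ : ∃ R : ℝ, ∀ t, B.kernel t ≠ 0 → |t| ≤ R := by
    obtain ⟨R, hR⟩ := (B.hasCompactSupport_kernel.isCompact.isBounded).subset_closedBall 0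
    refine ⟨R, fun t ht => ?_⟩
    have : t ∈ Metric.closedBall (0 : ℝ) R := hR (subset_tsupport _ ht)
    simpa [Real.dist_eq] using this
  set bound : ℝ → ℝ := fun t => |t| ^ (j + 1) * Real.exp ((‖z₀‖ + 1) * |t|) * ‖B.kernel t‖ with hbound
  have hF_meas : ∀ᶠ z in nhds z₀, AEStronglyMeasurable
      (fun t : ℝ => ((t : ℂ) ^ j * Complex.exp (z * t)) * B.kernel t) volume :=
    Filter.Eventually.of_forall fun z => (B.continuous_momentIntegrand j z).aestronglyMeasurable
  have hF_int : Integrable (fun t : ℝ => ((t : ℂ) ^ j * Complex.exp (z₀ * t)) * B.kernel t) volume :=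
    (B.continuous_momentIntegrand j z₀).integrable_of_hasCompactSupport (B.hasCompactSupport_momentIntegrand j z₀)
  have hF'_meas : AEStronglyMeasurable
      (fun t : ℝ => ((t : ℂ) ^ (j + 1) * Complex.exp (z₀ * t)) * B.kernel t) volume :=
    (B.continuous_momentIntegrand (j + 1) z₀).aestronglyMeasurable
  have hbound_int : Integrable bound volume := by
    refine Continuous.integrable_of_hasCompactSupport ?_ ?_
    · exact ((continuous_abs.pow _).mul (Real.continuous_exp.comp (continuous_const.mul continuous_abs))).mul
        (continuous_norm.comp B.continuous_kernel)
    · exact (B.hasCompactSupport_kernel.norm).mul_left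
  have hF'_bound : ∀ᵐ (t : ℝ) ∂volume, ∀ z ∈ Metric.ball z₀ 1,
      ‖((t : ℂ) ^ (j + 1) * Complex.exp (z * t)) * B.kernel t‖ ≤ bound t := by
    refine Filter.Eventually.of_forall fun t z hz => ?_
    rw [norm_mul, norm_mul, norm_pow, Complex.norm_real, Real.norm_eq_abs, hbound]
    refine mul_le_mul_of_nonneg_right (mul_le_mul_of_nonneg_left ?_ (by positivity)) (norm_nonneg _)
    rw [Complex.norm_exp]
    apply Real.exp_le_exp.mpr
    have h1 : (z * (t : ℂ)).re ≤ ‖z * (t : ℂ)‖ := Complex.re_le_norm _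
    rw [norm_mul, Complex.norm_real, Real.norm_eq_abs] at h1
    have h2 : ‖z‖ ≤ ‖z₀‖ + 1 := by
      have := Metric.mem_ball.mp hz
      rw [dist_eq_norm] at this
      have := norm_le_norm_add_norm_sub' z z₀
      linarith [norm_sub_rev z z₀]
    nlinarith [abs_nonneg t, norm_nonneg z]
  have hdiff : ∀ᵐ (t : ℝ) ∂volume, ∀ z ∈ Metric.ball z₀ 1,
      HasDerivAt (fun z => ((t : ℂ) ^ j * Complex.exp (z * t)) * B.kernel t)
        (((t : ℂ) ^ (j + 1) * Complex.exp (z * t)) * B.kernel t) z := by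
    refine Filter.Eventually.of_forall fun t z _ => ?_
    have h1 : HasDerivAt (fun w : ℂ => Complex.exp (w * t)) (Complex.exp (z * t) * t) z :=
      (hasDerivAt_mul_const (t : ℂ)).cexp
    have h2 : HasDerivAt (fun w : ℂ => ((t : ℂ) ^ j * Complex.exp (w * t)) * B.kernel t)
        (((t : ℂ) ^ j * (Complex.exp (z * t) * t)) * B.kernel t) z :=
      (h1.const_mul ((t : ℂ) ^ j)).mul_const (B.kernel t)
    rw [show ((t : ℂ) ^ (j + 1) * Complex.exp (z * t)) * B.kernel t =
      ((t : ℂ) ^ j * (Complex.exp (z * t) * t)) * B.kernel t by ring]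
    exact h2
  exact (hasDerivAt_integral_of_dominated_loc_of_deriv_le (Metric.ball_mem_nhds z₀ one_pos) hF_meas hF_int
    hF'_meas hF'_bound hbound_int hdiff).2

/-- `deriv M_j = M_{j+1}`. [folklore] -/
theorem deriv_moment (j : ℕ) : deriv (B.moment j) = B.moment (j + 1) :=
  funext fun z => (B.hasDerivAt_moment j z).deriv

/-- The moments are entire. [folklore] -/
theorem differentiable_moment (j : ℕ) : Differentiable ℂ (B.moment j) :=
  fun z => (B.hasDerivAt_moment j z).differentiableAt

/-- `∂^k M_j = M_{j+k}`. [folklore] -/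
theorem iteratedDeriv_moment (k j : ℕ) : iteratedDeriv k (B.moment j) = B.moment (j + k) := by
  induction k generalizing j with
  | zero => simp
  | succ k ih => rw [iteratedDeriv_succ', B.deriv_moment, ih, Nat.add_right_comm, Nat.add_assoc]

/-- `F` is entire. [folklore] -/
theorem differentiable_Fmain : Differentiable ℂ B.Fmain := by
  have : B.Fmain = fun z => B.moment 0 z - B.moment 0 0 := funext B.Fmain_eq
  rw [this]
  exact (B.differentiable_moment 0).sub (differentiable_const _)

/-- The bump with an extra `t^k`: `Φ_k(t) = t^k Φ(t)`. [folklore] -/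
def Φk (k : ℕ) : ConvFun :=
  ConvFun.mk (fun t => (t : ℂ) ^ k * B.Φ t) ((Complex.continuous_ofReal.pow k).mul B.Φ.continuous)
    B.Φ.hasCompactSupport.mul_left

/-- Ford's constants `Z_k = ∫_{U_M} u_1^k f_{1_M}(u)/(u_1⋯u_M)` for the product `f_{1_M}`:
`Z_k = (Φ_k * Φ^{*(M−1)})(1) = ∫ t^k Φ(t) Φ^{*(M−1)}(1 − t) dt`. [cite: Ford2004, Theorem 3 (Z_k)] -/
def Zk (k : ℕ) : ℝ := ((B.Φk k * B.Φ.cpow (B.M - 1)) 1).re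

/-- `M_k(0) = (Φ_k * Φ^{*(M−1)})(1)`. [folklore] -/
theorem moment_zero_eq (k : ℕ) : B.moment k 0 = (B.Φk k * B.Φ.cpow (B.M - 1)) 1 := by
  rw [moment, ConvFun.mul_apply]
  refine integral_congr_ae (Filter.Eventually.of_forall fun t => ?_)
  simp [kernel, Φk, ConvFun.mk_apply]
  ring

/-- `Φ_k` is real-valued. [folklore] -/
theorem isReal_Φk (k : ℕ) : (B.Φk k).IsReal := fun t => by
  rw [Φk, ConvFun.mk_apply, B.isReal.eq_ofReal t, ← Complex.ofReal_pow, ← Complex.ofReal_mul,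
    Complex.ofReal_im]

/-- `M_k(0) = Z_k`. [folklore] -/
theorem moment_zero_eq_Zk (k : ℕ) : B.moment k 0 = (B.Zk k : ℂ) := by
  rw [B.moment_zero_eq, Zk]
  have hM1 : B.M - 1 ≠ 0 := by have := B.two_le; omega
  exact ((B.isReal_Φk k).mul (B.isReal.cpow hM1)).eq_ofReal 1

/-- **`∂_z^k F(0) = Z_k`** for `k ≥ 1`. [folklore] -/
theorem iteratedDeriv_Fmain {k : ℕ} (hk : 1 ≤ k) : iteratedDeriv k B.Fmain 0 = (B.Zk k : ℂ) := by
  have : B.Fmain = B.moment 0 - fun _ => B.moment 0 0 := funext fun z => by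
    rw [B.Fmain_eq]; rfl
  rw [this, iteratedDeriv_sub ((B.differentiable_moment 0).contDiff.contDiffAt) contDiffAt_const,
    iteratedDeriv_const, if_neg (by omega), sub_zero, B.iteratedDeriv_moment, Nat.zero_add,
    B.moment_zero_eq_Zk]

/-- **`Z_k > 0`**: the integrand `t^k Φ(t) Φ^{*(M−1)}(1−t)` is non-negative and positive at
`t = 1/M` (where `Φ(1/M) > 0` and `Φ^{*(M−1)}((M−1)/M) > 0`). [cite: Ford2004, proof of Theorem 1] -/
theorem Zk_pos (k : ℕ) : 0 < B.Zk k := by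
  have hM0 := B.M_pos
  have hM1 : B.M - 1 ≠ 0 := by have := B.two_le; omega
  have ha : 0 < 1 / (B.M : ℝ) - B.w := B.ε_pos
  have hab : 1 / (B.M : ℝ) - B.w ≤ 1 / B.M + B.w := by linarith [B.w_pos]
  rw [Zk]
  have hk0 : ∀ t, 0 ≤ ((B.Φk k) t).re := by
    intro t
    rw [Φk, ConvFun.mk_apply, B.isReal.eq_ofReal t, ← Complex.ofReal_pow, ← Complex.ofReal_mul,
      Complex.ofReal_re]
    by_cases ht : B.Φ t = 0
    · rw [ht]; simp
    · have := (B.supp t ht).1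
      exact mul_nonneg (pow_nonneg (by linarith) k) (B.nonneg t)
  refine (B.isReal_Φk k).re_mul_apply_pos (B.isReal.cpow hM1) hk0
    (B.isReal.re_cpow_nonneg B.supp ha hab B.nonneg (B.M - 1)) (s₀ := 1 / B.M) ?_ ?_
  · rw [Φk, ConvFun.mk_apply, B.isReal.eq_ofReal, ← Complex.ofReal_pow, ← Complex.ofReal_mul,
      Complex.ofReal_re]
    exact mul_pos (pow_pos (by positivity) k) B.pos
  · have := B.isReal.re_cpow_pos B.supp ha hab B.nonneg (s₀ := 1 / B.M) B.pos hM1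
    have heq : (1 : ℝ) - 1 / B.M = ((B.M - 1 : ℕ) : ℝ) * (1 / B.M) := by
      rw [Nat.cast_sub (le_trans (by norm_num) B.two_le)]
      field_simp
      push_cast; ring
    rw [heq]; exact this

/-! ### Cauchy's estimate and the final `Λ_k`-asymptotic -/

/-- **Cauchy's estimate** on the unit circle: an entire `f` with `‖f‖ ≤ D` on `‖z‖ = 1` has
`‖f^{(k)}(0)‖ ≤ k! D`. [folklore] -/
theorem norm_iteratedDeriv_le {f : ℂ → ℂ} (hf : Differentiable ℂ f) {D : ℝ}
    (hD : ∀ z : ℂ, ‖z‖ = 1 → ‖f z‖ ≤ D) (k : ℕ) : ‖iteratedDeriv k f 0‖ ≤ k.factorial * D := by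
  have hD0 : 0 ≤ D := (norm_nonneg _).trans (hD 1 (by simp))
  have hc := DiffContOnCl.circleIntegral_one_div_sub_center_pow_smul one_pos k
    (hf.diffContOnCl (s := Metric.ball (0 : ℂ) 1))
  -- norm of the circle integral
  have hint : ‖∮ z in C(0, 1), (1 / (z - 0) ^ (k + 1)) • f z‖ ≤ 2 * Real.pi * |(1 : ℝ)| * D := by
    refine circleIntegral.norm_integral_le_of_norm_le_const' fun z hz => ?_
    rw [abs_one, Metric.mem_sphere, dist_zero_right] at hz
    rw [norm_smul, sub_zero, norm_div, norm_one, norm_pow, hz, one_pow, div_one, one_mul]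
    exact hD z hz
  rw [hc, norm_smul, abs_one, mul_one] at hint
  have hπ : ‖(2 * Real.pi * Complex.I / (k.factorial : ℂ))‖ = 2 * Real.pi / k.factorial := by
    rw [norm_div, norm_mul, norm_mul, Complex.norm_I, mul_one, Complex.norm_natCast, Complex.norm_ofNat,
      Complex.norm_real, Real.norm_eq_abs, abs_of_pos Real.pi_pos]
  rw [hπ] at hint
  have hfac : (0 : ℝ) < k.factorial := by exact_mod_cast k.factorial_pos
  rw [div_mul_eq_mul_div, div_le_iff₀ hfac] at hint
  have h2π : (0 : ℝ) < 2 * Real.pi := by positivity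
  nlinarith

/-- **The `Λ_k`-sums of the construction** ([Ford2004] (2.5) in perturbation form, i.e.
(3.12)–(3.13) with `W(M,N)` collapsed): for every `k ≥ 1` there are `C_k, x_k` with
`‖∑_{x < n ≤ x+xη} Λ_k(n) B(n) − (−1)^{M−1} Z_k · xη (log x)^{k−1}‖ ≤ C_k xη² (log x)^{k−1}`
for `x ≥ x_k`, `Z_k > 0` (`Zk_pos`). Proof: the generating sum `E_x(z)` equals
`(xη/log x)(−1)^{M−1}F(z) + O(xη²/log x)` uniformly on `‖z‖ ≤ 1` (`Egen_est`); both sides are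
entire, `∂_z^k E_x(0) = (log x)^{−k} ∑ Λ_k B` and `∂_z^k F(0) = Z_k`, and Cauchy's estimate bounds
the `k`-th derivative of the difference. [cite: Ford2004, Theorem 3 (3.9), (3.11)–(3.13)] -/
theorem lambdaK_est {c C : ℝ} (hc : 0 < c)
    (hPNT : ∀ u : ℝ, 2 ≤ u → |θ u - u| ≤ C * u / Real.exp (c * Real.sqrt (Real.log u)))
    {c₁ : ℝ} (hc₁ : 0 < c₁) (hc₁' : c₁ ≤ c * Real.sqrt B.ε / 4) {k : ℕ} (hk : 1 ≤ k) :
    ∃ Ck xk : ℝ, ∀ x : ℝ, xk ≤ x →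
      ‖B.LamSum c₁ x k - (((-1 : ℝ) ^ (B.M - 1) * B.Zk k * (x * eta c₁ x) *
          Real.log x ^ (k - 1) : ℝ) : ℂ)‖ ≤
        Ck * x * eta c₁ x ^ 2 * Real.log x ^ (k - 1) := by
  obtain ⟨D₀, x₁, hD₀, hE⟩ := B.Egen_est hc hPNT hc₁ hc₁'
  refine ⟨k.factorial * D₀, max x₁ (xThreshold B.ε), fun x hx => ?_⟩
  rw [max_le_iff] at hx
  obtain ⟨hx₁, hxT⟩ := hx
  obtain ⟨hxe, _, _⟩ := xThreshold_spec B.ε_pos B.ε_le_one hxT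
  have hx1 : 1 < x := lt_of_lt_of_le (by have := Real.add_one_le_exp (1:ℝ); linarith) hxe
  set η := eta c₁ x with hη
  set L := Real.log x with hL
  have hL0 : 0 < L := Real.log_pos hx1
  have hLc : (L : ℂ) ≠ 0 := by exact_mod_cast hL0.ne'
  -- the error function and its derivative at `0`
  set Err : ℂ → ℂ := fun z => B.Egen c₁ x z - ((x * η / L : ℝ) : ℂ) * ((-1) ^ (B.M - 1) * B.Fmain z) with hErr
  have hErr_diff : Differentiable ℂ Err :=
    (B.contDiff_Egen c₁ x (n := 1)).differentiable one_ne_zero |>.sub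
      ((B.differentiable_Fmain.const_mul _).const_mul _)
  have hbound : ∀ z : ℂ, ‖z‖ = 1 → ‖Err z‖ ≤ D₀ * x * η ^ 2 / L := fun z hz => hE x hx₁ z hz.le
  have hCauchy := norm_iteratedDeriv_le hErr_diff hbound k
  -- compute the derivative
  have hderiv : iteratedDeriv k Err 0 =
      B.LamSum c₁ x k / (L : ℂ) ^ k - ((x * η / L : ℝ) : ℂ) * ((-1) ^ (B.M - 1) * (B.Zk k : ℂ)) := by
    have h1 : Err = B.Egen c₁ x - fun z => ((x * η / L : ℝ) : ℂ) * ((-1) ^ (B.M - 1) * B.Fmain z) := rfl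
    rw [h1, iteratedDeriv_sub (B.contDiff_Egen c₁ x).contDiffAt
      ((B.differentiable_Fmain.contDiff.contDiffAt.const_smul ((-1 : ℂ) ^ (B.M - 1))).const_smul
        (((x * η / L : ℝ) : ℂ)) |>.congr_of_eventuallyEq (Filter.Eventually.of_forall fun z => by
          simp [smul_eq_mul])),
      B.iteratedDeriv_Egen]
    rw [iteratedDeriv_const_mul _ ((B.differentiable_Fmain.contDiff.contDiffAt.const_smul
        ((-1 : ℂ) ^ (B.M - 1))).congr_of_eventuallyEq (Filter.Eventually.of_forall fun z => by
          simp [smul_eq_mul])),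
      iteratedDeriv_const_mul _ B.differentiable_Fmain.contDiff.contDiffAt, B.iteratedDeriv_Fmain hk]
  rw [hderiv] at hCauchy
  -- multiply through by `L^k`
  have hscale : B.LamSum c₁ x k - (((-1 : ℝ) ^ (B.M - 1) * B.Zk k * (x * η) * L ^ (k - 1) : ℝ) : ℂ) =
      (L : ℂ) ^ k * (B.LamSum c₁ x k / (L : ℂ) ^ k - ((x * η / L : ℝ) : ℂ) * ((-1) ^ (B.M - 1) * (B.Zk k : ℂ))) := by
    rw [mul_sub, mul_div_cancel₀ _ (pow_ne_zero k hLc)]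
    congr 1
    obtain ⟨j, rfl⟩ : ∃ j, k = j + 1 := ⟨k - 1, by omega⟩
    rw [Nat.add_sub_cancel]
    push_cast
    field_simp
    ring
  rw [hscale, norm_mul, norm_pow, Complex.norm_real, Real.norm_eq_abs, abs_of_pos hL0]
  calc L ^ k * ‖B.LamSum c₁ x k / (L : ℂ) ^ k - ((x * η / L : ℝ) : ℂ) * ((-1) ^ (B.M - 1) * (B.Zk k : ℂ))‖
      ≤ L ^ k * (k.factorial * (D₀ * x * η ^ 2 / L)) := mul_le_mul_of_nonneg_left hCauchy (by positivity)
    _ = k.factorial * D₀ * x * η ^ 2 * L ^ (k - 1) := by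
        obtain ⟨j, rfl⟩ : ∃ j, k = j + 1 := ⟨k - 1, by omega⟩
        rw [Nat.add_sub_cancel, pow_succ]
        field_simp

end Bump

end Literature.NumberTheory.Sieve.Ford2004
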